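import Summits.Ventures.PercRepro.S1TriangleCoverSeventeen

/-!
# PercRepro — THE UNION OF THE TRIANGLES OF A `(10, 17)` CORE HAS NULLITY `6` (p2, gen 25; SUBCLAIM-S1 §6.9 (x))

Let `M` be a coloop-free `e`-free core of nullity `7` with `17` points and `s₃ ≥ 9` triangles, and `S₀` the union
of its triangles. Then `S₀ ≠ E` (S1TriangleCoverSeventeen), `ν(S₀) = 6` (`≤ 6` as `S₀ ⊊ E`, `≥ 6` as it holds
`s₃ > cq3 5` triangles), and every four-circuit lies inside `S₀` or contains `E ∖ S₀` (a circuit `C ⊄ S₀` raises the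
nullity: `ν(S₀ ∪ C) ≥ ν(S₀) + 1 = 7`, so `S₀ ∪ C = E` on the coloop-free `M`). The counts: `s₃ ≤ cq3 6 = 10`;
the triangle lever `s₃ ≤ ⌊7·|S₀|/(|S₀| − 3)⌋` gives `|S₀| ≤ 10` at `s₃ = 10` and `|S₀| ≤ 13` at `s₃ = 9`; and
every point of `S₀` lies on `≥ s₃ − 7` triangles (the triangles avoiding it sit in `S₀ ∖ x`, of nullity `5`).

* `eRk_union_circuit_add_le` — a circuit not inside `S` raises the nullity of `S` by at least one;
* **`exists_triangle_union`** — `S₀`: proper, covered by its triangles, holding every triangle, nullity `6`,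
  every four-circuit inside it or containing its complement;
* **`triangle_union_bounds`** — `s₃ ≤ 10`, `|S₀| ≤ 10` at `s₃ = 10`, `|S₀| ≤ 13` at `s₃ = 9`, degrees `≥ s₃ − 7`.
Axioms: standard.
-/

open scoped Matroid

namespace PercRepro

namespace S1

open Set

variable {α : Type}

/-- **A circuit not inside `S` raises the nullity**: for `S ⊆ E` with `ν(S) = d` and a circuit `C ⊄ S`,
`ν(S ∪ C) ≥ d + 1` (submodularity with `S ∩ C` independent and `r(C) = |C| − 1`). -/
theorem eRk_union_circuit_add_le (M : Matroid α) [M.Finite] {S C : Set α} (hS : S ⊆ M.E)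
    (hC : M.IsCircuit C) (hCS : ¬ C ⊆ S) {d : ℕ} (hν : S.encard = M.eRk S + (d : ℕ∞)) :
    M.eRk (S ∪ C) + ((d + 1 : ℕ) : ℕ∞) ≤ ((S ∪ C).ncard : ℕ∞) := by
  have hEfin : M.E.Finite := M.ground_finite
  have hCE : C ⊆ M.E := hC.subset_ground
  have hSfin : S.Finite := hEfin.subset hS
  have hCfin : C.Finite := hEfin.subset hCE
  have hUfin : (S ∪ C).Finite := hSfin.union hCfin
  have hIfin : (S ∩ C).Finite := hSfin.subset inter_subset_left
  have hI : M.Indep (S ∩ C) :=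
    hC.ssubset_indep (Set.ssubset_iff_subset_ne.2 ⟨inter_subset_right, fun h => hCS (h ▸ inter_subset_left)⟩)
  have hIr : M.eRk (S ∩ C) = (S ∩ C).encard := hI.eRk_eq_encard
  have hCr : M.eRk C + 1 = C.encard := hC.eRk_add_one_eq
  have hsub : M.eRk (S ∩ C) + M.eRk (S ∪ C) ≤ M.eRk S + M.eRk C := M.eRk_inter_add_eRk_union_le S C
  have hcard : (S ∪ C).encard + (S ∩ C).encard = S.encard + C.encard := Set.encard_union_add_encard_inter S C
  have hfin : ∀ X ⊆ M.E, M.eRk X ≠ ⊤ := fun X hX =>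
    ((M.eRk_le_encard X).trans_lt (hEfin.subset hX).encard_lt_top).ne
  obtain ⟨rS, hrS⟩ := ENat.ne_top_iff_exists.1 (hfin S hS)
  obtain ⟨rC, hrC⟩ := ENat.ne_top_iff_exists.1 (hfin C hCE)
  obtain ⟨rU, hrU⟩ := ENat.ne_top_iff_exists.1 (hfin (S ∪ C) (union_subset hS hCE))
  obtain ⟨nS, hnS⟩ := ENat.ne_top_iff_exists.1 hSfin.encard_lt_top.ne
  obtain ⟨nC, hnC⟩ := ENat.ne_top_iff_exists.1 hCfin.encard_lt_top.ne
  obtain ⟨nU, hnU⟩ := ENat.ne_top_iff_exists.1 hUfin.encard_lt_top.ne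
  obtain ⟨nI, hnI⟩ := ENat.ne_top_iff_exists.1 hIfin.encard_lt_top.ne
  rw [← hnI] at hIr
  rw [← hrC, ← hnC] at hCr
  rw [hIr, ← hrU, ← hrS, ← hrC] at hsub
  rw [← hnU, ← hnI, ← hnS, ← hnC] at hcard
  rw [← hnS, ← hrS] at hν
  rw [← hrU, hUfin.cast_ncard_eq, ← hnU]
  have hCr' : rC + 1 = nC := by exact_mod_cast hCr
  have hsub' : nI + rU ≤ rS + rC := by exact_mod_cast hsub
  have hcard' : nU + nI = nS + nC := by exact_mod_cast hcard
  have hν' : nS = rS + d := by exact_mod_cast hν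
  norm_cast
  omega

open Classical in
/-- **THE UNION OF THE TRIANGLES**: on a coloop-free `e`-free core of nullity `7` with `17` points and `≥ 9`
triangles, the union `S₀` of the triangles is a proper subset of `E`, covered by its triangles, holding every
triangle, of nullity exactly `6`, and every four-circuit lies inside `S₀` or contains `E ∖ S₀`. -/
theorem exists_triangle_union (M : Matroid α) [M.Finite]
    (hfree : ∀ e ∈ M.E, ∃ A ⊆ M.E \ {e}, e ∉ M.closure A ∧ e ∉ M.closure ((M.E \ {e}) \ A))
    (hd : M.E.encard = M.eRank + ((7 : ℕ) : ℕ∞)) (hn : M.E.ncard = 17) (hcol : M.coloops = ∅)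
    (h9 : 9 ≤ {C : Set α | M.IsCircuit C ∧ C.ncard = 3}.ncard) :
    ∃ S ⊆ M.E, S ≠ M.E ∧ (∀ x ∈ S, ∃ C, M.IsCircuit C ∧ C.ncard = 3 ∧ C ⊆ S ∧ x ∈ C) ∧
      (∀ C, M.IsCircuit C → C.ncard = 3 → C ⊆ S) ∧ S.encard = M.eRk S + ((6 : ℕ) : ℕ∞) ∧
      (∀ C, M.IsCircuit C → C.ncard = 4 → C ⊆ S ∨ M.E \ S ⊆ C) := by
  have hmem𝒯 : ∀ C, C ∈ (finite_triangles M).toFinset ↔ M.IsCircuit C ∧ C.ncard = 3 := fun C => by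
    rw [Set.Finite.mem_toFinset]; rfl
  have h𝒯card : (finite_triangles M).toFinset.card = {C : Set α | M.IsCircuit C ∧ C.ncard = 3}.ncard :=
    (Set.ncard_eq_toFinset_card _ (finite_triangles M)).symm
  obtain ⟨hSE, -, -, hsub, heq⟩ :=
    triangle_union_facts M ∅ (⋃ C ∈ (finite_triangles M).toFinset.filter (fun C => ∀ x ∈ (∅ : Set α), x ∉ C), C) rfl
  set S := ⋃ C ∈ (finite_triangles M).toFinset.filter (fun C => ∀ x ∈ (∅ : Set α), x ∉ C), C with hSdef
  have hvac : ∀ C : Set α, ∀ x ∈ (∅ : Set α), x ∉ C := fun C x hx => absurd hx (Set.notMem_empty x)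
  have hsub' : ∀ C, M.IsCircuit C → C.ncard = 3 → C ⊆ S := fun C hC h3 => hsub C hC h3 (hvac C)
  have hcov : ∀ x ∈ S, ∃ C, M.IsCircuit C ∧ C.ncard = 3 ∧ C ⊆ S ∧ x ∈ C := by
    intro x hx
    rw [hSdef, Set.mem_iUnion₂] at hx
    obtain ⟨C, hC, hxC⟩ := hx
    have hC3 := (hmem𝒯 C).1 (Finset.mem_filter.1 hC).1
    exact ⟨C, hC3.1, hC3.2, hsub' C hC3.1 hC3.2, hxC⟩
  -- the triangles inside `S` are all the triangles
  have hStri : {C : Set α | M.IsCircuit C ∧ C.ncard = 3 ∧ C ⊆ S}.ncard = {C : Set α | M.IsCircuit C ∧ C.ncard = 3}.ncard := by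
    rw [heq, Set.ncard_coe_finset, ← h𝒯card]
    congr 1
    apply Finset.filter_true_of_mem
    intro C _
    exact hvac C
  -- `S ≠ E`
  have hne : S ≠ M.E := by
    intro hSE'
    obtain ⟨x, hxE, hx⟩ := exists_notMem_triangles_of_nine M hfree hd hn hcol h9
    rw [← hSE'] at hxE
    obtain ⟨C, hC, h3, -, hxC⟩ := hcov x hxE
    exact hx C hC h3 hxC
  -- the nullity is exactly `6`
  obtain ⟨ν, hν⟩ := exists_nullity M hSE
  have hSfin : S.Finite := M.ground_finite.subset hSE
  have hνle : ν + 1 ≤ 7 := by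
    refine nullity_add_one_le_of_ssubset_of_coloops_empty M hcol hd hSE hne ?_
    rw [hSfin.cast_ncard_eq, hν]
  have htri_le := ncard_triangles_subset_le_cq3 M hfree hSE hν
  rw [hStri] at htri_le
  have hνeq : ν = 6 := by
    have hcq : ν ≤ 5 → TriangleCap.cq3 ν ≤ 7 := by
      intro h
      interval_cases ν <;> decide
    by_contra hne'
    have := hcq (by omega)
    omega
  rw [hνeq] at hν
  refine ⟨S, hSE, hne, hcov, hsub', hν, ?_⟩
  -- the four-circuits
  intro C hC h4
  by_cases hCS : C ⊆ S
  · exact Or.inl hCS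
  · right
    have hU := eRk_union_circuit_add_le M hSE hC hCS hν
    have hUE : S ∪ C = M.E := by
      by_contra hUE
      have := nullity_add_one_le_of_ssubset_of_coloops_empty M hcol hd (union_subset hSE hC.subset_ground) hUE hU
      omega
    intro x hx
    have : x ∈ S ∪ C := hUE ▸ hx.1
    exact this.resolve_left hx.2

/-- **THE COUNTS ON THE UNION OF THE TRIANGLES**: for `S ⊆ E` covered by its triangles, holding every triangle,
of nullity `6`, on a `17`-point core: `s₃ ≤ 10`; `|S| ≤ 10` when `s₃ = 10` and `|S| ≤ 13` when
`s₃ = 9` (the triangle lever); and every point of `S` lies on at least `s₃ − 7` triangles. -/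
theorem triangle_union_bounds (M : Matroid α) [M.Finite]
    (hfree : ∀ e ∈ M.E, ∃ A ⊆ M.E \ {e}, e ∉ M.closure A ∧ e ∉ M.closure ((M.E \ {e}) \ A))
    (hn : M.E.ncard = 17) {S : Set α} (hS : S ⊆ M.E)
    (hcov : ∀ x ∈ S, ∃ C, M.IsCircuit C ∧ C.ncard = 3 ∧ C ⊆ S ∧ x ∈ C)
    (hsub : ∀ C, M.IsCircuit C → C.ncard = 3 → C ⊆ S)
    (hν : S.encard = M.eRk S + ((6 : ℕ) : ℕ∞)) :
    {C : Set α | M.IsCircuit C ∧ C.ncard = 3}.ncard ≤ 10 ∧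
      ({C : Set α | M.IsCircuit C ∧ C.ncard = 3}.ncard = 10 → S.ncard ≤ 10) ∧
      ({C : Set α | M.IsCircuit C ∧ C.ncard = 3}.ncard = 9 → S.ncard ≤ 13) ∧
      (∀ x ∈ S, {C : Set α | M.IsCircuit C ∧ C.ncard = 3}.ncard ≤
        {C : Set α | M.IsCircuit C ∧ C.ncard = 3 ∧ x ∈ C}.ncard + 7) := by
  have hEfin : M.E.Finite := M.ground_finite
  have hSfin : S.Finite := hEfin.subset hS
  have hStri : {C : Set α | M.IsCircuit C ∧ C.ncard = 3 ∧ C ⊆ S} = {C : Set α | M.IsCircuit C ∧ C.ncard = 3} := by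
    ext C
    simp only [Set.mem_setOf_eq]
    exact ⟨fun h => ⟨h.1, h.2.1⟩, fun h => ⟨h.1, h.2, hsub C h.1 h.2⟩⟩
  -- `s₃ ≤ cq3 6 = 10`
  have h10 : {C : Set α | M.IsCircuit C ∧ C.ncard = 3}.ncard ≤ 10 := by
    have h := ncard_triangles_subset_le_cq3 M hfree hS hν
    rw [hStri] at h
    exact h.trans (by decide)
  -- `6 ≤ |S| ≤ 17`
  have hSge : 6 ≤ S.ncard := by
    have hr : M.eRk S ≠ ⊤ := ((M.eRk_le_encard S).trans_lt hSfin.encard_lt_top).ne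
    obtain ⟨r, hr⟩ := ENat.ne_top_iff_exists.1 hr
    have h := hν
    rw [← hr, ← hSfin.cast_ncard_eq] at h
    have h' : S.ncard = r + 6 := by exact_mod_cast h
    omega
  have hSle : S.ncard ≤ 17 := by
    have := Set.ncard_le_ncard hS hEfin
    omega
  -- the lever
  have hlever := ncard_triangles_subset_le_lever M hfree hS
    (fun x hx => by obtain ⟨C, hC, -, hCS, hxC⟩ := hcov x hx; exact ⟨C, hC, hCS, hxC⟩) (ν := 5) hν (by omega)
  rw [hStri] at hlever
  have hcq5 : TriangleCap.cq3 5 = 7 := by decide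
  rw [hcq5] at hlever
  obtain ⟨m, hm⟩ : ∃ m, S.ncard = m := ⟨_, rfl⟩
  rw [hm] at hlever hSge hSle
  refine ⟨h10, ?_, ?_, ?_⟩
  · intro hs
    rw [hs] at hlever
    rw [hm]
    by_contra hlt
    push Not at hlt
    have : m * 7 / (m - 3) ≤ 9 := by interval_cases m <;> decide
    omega
  · intro hs
    rw [hs] at hlever
    rw [hm]
    by_contra hlt
    push Not at hlt
    have : m * 7 / (m - 3) ≤ 8 := by interval_cases m <;> decide
    omega
  -- the degrees
  · intro x hx
    obtain ⟨T, hT, hT3, hTS, hxT⟩ := hcov x hx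
    have hX : (S \ {x}).encard = M.eRk (S \ {x}) + ((6 - 1 : ℕ) : ℕ∞) := by
      refine nullity_of_subset_closure M sdiff_subset hS ?_ hν ?_
      · intro y hy
        by_cases hyx : y = x
        · rw [hyx]
          refine M.closure_subset_closure ?_ (hT.mem_closure_sdiff_singleton_of_mem hxT)
          exact fun z hz => ⟨hTS hz.1, hz.2⟩
        · exact M.subset_closure _ (sdiff_subset.trans hS) ⟨hy, by simp [hyx]⟩
      · rw [Set.sdiff_sdiff_cancel_left (Set.singleton_subset_iff.2 hx), Set.encard_singleton]
        rfl
    have hB := ncard_triangles_subset_le_cq3 M hfree (sdiff_subset.trans hS) hX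
    have hcq5' : TriangleCap.cq3 (6 - 1) = 7 := by decide
    rw [hcq5'] at hB
    -- split the triangles by `x`
    have hAfin : {C : Set α | M.IsCircuit C ∧ C.ncard = 3 ∧ x ∈ C}.Finite :=
      (finite_triangles M).subset (fun C hC => ⟨hC.1, hC.2.1⟩)
    have hBfin : {C : Set α | M.IsCircuit C ∧ C.ncard = 3 ∧ C ⊆ S \ {x}}.Finite :=
      (finite_triangles M).subset (fun C hC => ⟨hC.1, hC.2.1⟩)
    have hunion : {C : Set α | M.IsCircuit C ∧ C.ncard = 3} =
        {C : Set α | M.IsCircuit C ∧ C.ncard = 3 ∧ x ∈ C} ∪ {C : Set α | M.IsCircuit C ∧ C.ncard = 3 ∧ C ⊆ S \ {x}} := by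
      ext C
      simp only [Set.mem_setOf_eq, Set.mem_union]
      constructor
      · rintro ⟨hC, h3⟩
        by_cases hxC : x ∈ C
        · exact Or.inl ⟨hC, h3, hxC⟩
        · exact Or.inr ⟨hC, h3, fun y hy => ⟨hsub C hC h3 hy, fun h => hxC (h ▸ hy)⟩⟩
      · rintro (⟨hC, h3, -⟩ | ⟨hC, h3, -⟩) <;> exact ⟨hC, h3⟩
    have hdisj : Disjoint {C : Set α | M.IsCircuit C ∧ C.ncard = 3 ∧ x ∈ C}
        {C : Set α | M.IsCircuit C ∧ C.ncard = 3 ∧ C ⊆ S \ {x}} := by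
      rw [Set.disjoint_left]
      rintro C ⟨-, -, hxC⟩ ⟨-, -, hCS⟩
      exact (hCS hxC).2 rfl
    rw [hunion, Set.ncard_union_eq hdisj hAfin hBfin]
    omega

end S1

end PercRepro
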